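import Literature.ModelTheory.ExponentialFields.WilkieConjecture
import Literature.ModelTheory.ExponentialFields.RealExpOMinimal
import HarnessLib

/-!
# Wilkie's conjecture for `ℝ_exp` (Binyamini–Novikov–Zak 2024, Cor. 1) — proof file

Sibling proof file of `WilkieConjecture.lean` (the named fact
`BinyaminiNovikovZak2024_cor_1_rat`: for `X ⊆ ℝⁿ` definable in `ℝ_exp`,
`#X^trans(ℚ, H) ≤ c (log H + 1)^κ`).

Source: G. Binyamini, D. Novikov, B. Zak, *Wilkie's conjecture for Pfaffian structures*, Ann. of
Math. 199 (2024) = arXiv:2202.05305 [BinyaminiNovikovZak2024], §1.1, proof of Cor. 1 (p. 3 of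
the arXiv version, read): *"By Wilkie's theorem of the complement we have `X = π_n(Y)` where
`Y ⊂ ℝ^N` is quantifier-free in `ℝ_exp`, and `π_n : ℝ^N → ℝⁿ` is the projection to the first `n`
coordinates. Let `g, H ∈ ℕ` and choose `M ≫ 1` such that `X(g, H) = X_M(g, H)` where
`X_M := π_n(Y_M)`, `Y_M := Y ∩ [-M, M]^N`. Now `Y_M` is restricted semi-Pfaffian … Crucially,
`Y_M ∈ Ω_{F,D}` where `F, D` depend on `Y` but not on `M`. Then the same is true for `X_M`, and
we conclude `#X^trans(g, H) ≤ #X_M^trans(g, H) = poly_X(g, log H)` by Theorem 1."*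

## Architecture of the printed proof and status in the tree

1. Wilkie's theorem of the complement / model completeness of `ℝ_exp` (Wilkie 1996): in the tree
   only as the *unproved* named fact `wilkie_isModelComplete` (`RealExpField.lean`). **Given
   (MC), the presentation `X = π_n(Y)` is proved here** in the sharper normal form the tree
   already has for subsets of the line (`exists_eq_image_realZeroSet_of_definable₁`,
   `RealExpOMinimal.lean`): `Y = Z(Q) = {z̄ ∈ ℝⁿ⁺ᴺ | Q(z̄, e^{z̄}) = 0}` for a real polynomial `Q`
   (Robinson's test `Theory.IsModelComplete.exists_isExistential_iff`, the one-term normal form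
   `RealExpModel.exists_term_iff_realize_of_isExistential` and the unravelling of nested
   exponentials `RealExpModel.exists_expPoly_iff_real`) — `exists_eq_image_realZeroSet_of_definable`.
2. Truncation (`g = 1`): `X(ℚ, H)` is finite and lies in `[-H, H]ⁿ`; `X ↦ X^alg` is monotone, so
   `X^trans ∩ X' ⊆ X'^trans` for `X' ⊆ X`; hence `#X^trans(ℚ, H) ≤ #X'^trans(ℚ, H)` whenever
   `X(ℚ, H) ⊆ X' ⊆ X` — for `X' = X ∩ [-M, M]ⁿ` (`M ≥ H`) and for `X' = π(Y ∩ [-M, M]^N)`, `M`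
   large. **Proved here** (section `Truncation`).
3. `Y_M` restricted semi-Pfaffian of format/degree independent of `M`, and
4. Theorem 1 (polylogarithmic counting for the format–degree filtration of the sharply o-minimal
   structure `ℝ_rPfaff`; BNZ §2–§7 with Binyamini–Vorobjov and Gabrielov–Vorobjov): no
   counterpart in the tree (no restricted-Pfaffian vocabulary); not formalised.

## Contents (all proved)

* `algPart_mono`, `inter_transPart_subset_transPart`, `ratPointsLE_mono_left`,
  `ratPointsLE_eq_inter_univ`;
* `abs_ratCast_le_of_mulHeight₁_le` (`|a/b| ≤ H(a/b)`), `abs_le_of_mem_ratPointsLE`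
  (`X(ℚ, H) ⊆ [-H, H]ⁿ`), `ratPointsLE_subset_inter_box`;
* `ratPointsLE_finite`, `ratPointsLE_transPart_finite` — `X(ℚ, H)` is finite (Northcott's
  theorem on `ℚ`, Mathlib's `NumberField.finite_setOf_mulHeight₁_le`): the finiteness conjunct of
  the fact is unconditional, whence `BinyaminiNovikovZak2024_cor_1_rat_iff_ncard`;
* `ratPointsLE_transPart_subset`, `ncard_ratPointsLE_transPart_le`,
  `ratPointsLE_transPart_subset_inter_box`, `exists_ratPointsLE_image_subset`,
  `exists_ncard_ratPointsLE_transPart_image_le` — step 2 as printed;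
* `BinyaminiNovikovZak2024_cor_1_rat_of_boxes` — the fact follows from a polylogarithmic bound
  for the box truncations `X ∩ [-M, M]ⁿ` of definable sets that is uniform in `M` (the shape in
  which Thm. 1 enters).
* `exists_eq_image_realZeroSet_of_definable` — step 1 given (MC): a set `X ⊆ ℝⁿ` definable with
  parameters in `ℝ_exp` is `π_n(Z(Q))` for a real exponential zero set
  `Z(Q) ⊆ ℝⁿ⁺ᴺ` (`ExpPoly.realZeroSet`).
* `BinyaminiNovikovZak2024_cor_1_rat_of_isModelComplete` — **the printed proof of Cor. 1 modulo
  Theorem 1**: `wilkie_isModelComplete` together with the Theorem-1-shaped bound for the family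
  `X_M = π_n(Z(Q) ∩ [-M, M]ⁿ⁺ᴺ)` (polylogarithmic in `H`, uniform in `M` — steps 3–4) imply
  `BinyaminiNovikovZak2024_cor_1_rat`.
* Section `LowDimension` — the cases `n ≤ 1` of the fact need no point counting:
  `IsFiniteUnionOfIntervals.exists_finite_forall_Ioo_subset`,
  `transPart_finite_of_isFiniteUnionOfIntervals` (in `ℝ¹`, `X^trans` is finite once `X` is a
  finite union of points and intervals), `BinyaminiNovikovZak2024_cor_1_rat_one_of_isOMinimal`
  (`n = 1` from `wilkie_isOMinimal`), `BinyaminiNovikovZak2024_cor_1_rat_zero` (`n = 0`).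
  (The interpolation step of Thm. 1, BNZ Prop. 23 for `g = 1`, is formalised in
  `InterpolationDeterminant.lean`, `BombieriPilaDeterminant.lean`, `InterpolationStep.lean`.)

## References

* G. Binyamini, D. Novikov, B. Zak, Ann. of Math. 199 (2024), 795–821,
  doi:10.4007/annals.2024.199.2.5 = arXiv:2202.05305: §1.1, Cor. 1 and its proof.
  [BinyaminiNovikovZak2024]
* A. J. Wilkie, *Model completeness results for expansions of the ordered field of real numbers
  by restricted Pfaffian functions and the exponential function*, JAMS 9 (1996). [WilkieJAMS1996]
* M. den Besten, *Wilkie's Theorem and the Uniform Real Schanuel Conjecture*, MSc thesis, Utrecht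
  (2016): Lemma 2.1.5, Cor. 4.2.7, Cor. 8.3.5 (existential normal form; definable sets of a model
  complete `ℝ_exp` as projections of exponential zero sets). [DenBesten2016]
-/

noncomputable section

open Set FirstOrder FirstOrder.Language

namespace Literature.ModelTheory.ExponentialFields

/-! ### Step 2 of the printed proof: truncation to boxes (set-theoretic lemmas, `g = 1`) -/

section Truncation

variable {ι : Type*}

/-- `X ↦ X^alg` is monotone: a connected infinite semialgebraic subset of `X` is one of any
`Y ⊇ X`. [folklore] -/
theorem algPart_mono {X Y : Set (ι → ℝ)} (h : X ⊆ Y) : algPart X ⊆ algPart Y := by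
  intro x hx
  rw [mem_algPart_iff] at hx ⊢
  obtain ⟨A, hxA, hAX, hA⟩ := hx
  exact ⟨A, hxA, hAX.trans h, hA⟩

/-- For `X' ⊆ X`, the points of `X'` lying in the transcendental part of `X` lie in the
transcendental part of `X'` (Binyamini–Novikov–Zak 2024, proof of Cor. 1:
`X^trans ∩ X_M ⊆ X_M^trans`). [cite: BinyaminiNovikovZak2024, proof of Cor. 1] -/
theorem inter_transPart_subset_transPart {X X' : Set (ι → ℝ)} (h : X' ⊆ X) :
    X' ∩ transPart X ⊆ transPart X' := by
  rintro x ⟨hxX', -, hxalg⟩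
  exact ⟨hxX', fun hx ↦ hxalg (algPart_mono h hx)⟩

/-- `X(ℚ, H)` is monotone in `X`. [folklore] -/
theorem ratPointsLE_mono_left {X Y : Set (ι → ℝ)} (h : X ⊆ Y) (H : ℕ) :
    ratPointsLE X H ⊆ ratPointsLE Y H :=
  fun _ hx ↦ ⟨h hx.1, hx.2⟩

/-- `X(ℚ, H) = X ∩ ℝⁿ(ℚ, H)`: the rational points of height `≤ H` of `X` are those of the
ambient space that lie in `X`. [folklore] -/
theorem ratPointsLE_eq_inter_univ (X : Set (ι → ℝ)) (H : ℕ) :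
    ratPointsLE X H = X ∩ ratPointsLE Set.univ H := by
  ext x
  simp only [mem_ratPointsLE_iff, mem_inter_iff, mem_univ, true_and]

/-- A rational number of (multiplicative Weil) height `≤ H` has absolute value `≤ H`:
`|a/b| ≤ |a| ≤ max(|a|, b) = H(a/b)`. [folklore] -/
theorem abs_ratCast_le_of_mulHeight₁_le {q : ℚ} {H : ℕ} (h : Height.mulHeight₁ q ≤ H) :
    |(q : ℝ)| ≤ H := by
  rw [Rat.mulHeight₁_eq_max] at h
  push_cast at h
  have hnum : ((q.num.natAbs : ℕ) : ℝ) = |(q.num : ℝ)| := by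
    rw [Nat.cast_natAbs, Int.cast_abs]
  have hden : (1 : ℝ) ≤ q.den := by exact_mod_cast q.pos
  have hq : (q : ℝ) = q.num / q.den := Rat.cast_def q
  calc |(q : ℝ)| = |(q.num : ℝ)| / q.den := by
        rw [hq, abs_div, abs_of_pos (by positivity : (0 : ℝ) < q.den)]
    _ ≤ |(q.num : ℝ)| := div_le_self (abs_nonneg _) hden
    _ = ((q.num.natAbs : ℕ) : ℝ) := hnum.symm
    _ ≤ H := (le_max_left _ _).trans h

/-- The points of `X(ℚ, H)` lie in the box `[-H, H]^n` (Binyamini–Novikov–Zak 2024, proof of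
Cor. 1: `X(g, H) = X_M(g, H)` for `M ≫ 1`; for `g = 1` any `M ≥ H` works). [folklore] -/
theorem abs_le_of_mem_ratPointsLE {X : Set (ι → ℝ)} {H : ℕ} {x : ι → ℝ}
    (hx : x ∈ ratPointsLE X H) (i : ι) : |x i| ≤ H := by
  obtain ⟨q, hq, hqH⟩ := hx.2 i
  rw [← hq]
  exact abs_ratCast_le_of_mulHeight₁_le hqH

/-- `X(ℚ, H) ⊆ X ∩ [-M, M]^n` for `M ≥ H`. [folklore] -/
theorem ratPointsLE_subset_inter_box (X : Set (ι → ℝ)) {H : ℕ} {M : ℝ} (hM : (H : ℝ) ≤ M) :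
    ratPointsLE X H ⊆ X ∩ {x | ∀ i, |x i| ≤ M} :=
  fun _ hx ↦ ⟨hx.1, fun i ↦ (abs_le_of_mem_ratPointsLE hx i).trans hM⟩

/-- **`X(ℚ, H)` is finite** for `X ⊆ ℝⁿ` (`n` finite): rationals of bounded height form a finite
set (Northcott's theorem for `ℚ`, Mathlib's `NumberField.finite_setOf_mulHeight₁_le`), so the
finiteness conjunct of `BinyaminiNovikovZak2024_cor_1_rat` holds unconditionally. [folklore] -/
theorem ratPointsLE_finite [Finite ι] (X : Set (ι → ℝ)) (H : ℕ) : (ratPointsLE X H).Finite := by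
  have hfin : (Set.univ.pi fun _ : ι ↦ {q : ℚ | Height.mulHeight₁ q ≤ H}).Finite :=
    Set.Finite.pi fun _ ↦ NumberField.finite_setOf_mulHeight₁_le ℚ H
  refine (hfin.image fun f : ι → ℚ ↦ fun i ↦ (f i : ℝ)).subset ?_
  intro x hx
  choose f hf hfH using hx.2
  refine ⟨f, ?_, funext hf⟩
  simpa only [mem_pi, mem_univ, mem_setOf_eq, forall_const] using hfH

/-- `X^trans(ℚ, H)` is finite, unconditionally (the finiteness half of Cor. 1). [folklore] -/
theorem ratPointsLE_transPart_finite [Finite ι] (X : Set (ι → ℝ)) (H : ℕ) :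
    (ratPointsLE (transPart X) H).Finite :=
  ratPointsLE_finite _ H

/-- **Truncation step of the printed proof of Cor. 1.** If `X(ℚ, H) ⊆ X' ⊆ X` then
`X^trans(ℚ, H) ⊆ X'^trans(ℚ, H)` (Binyamini–Novikov–Zak 2024, proof of Cor. 1, with
`X' = X_M`: *"`#X^trans(g, H) ≤ #X_M^trans(g, H)`"*). [cite: BinyaminiNovikovZak2024, proof of Cor. 1] -/
theorem ratPointsLE_transPart_subset {X X' : Set (ι → ℝ)} {H : ℕ} (h' : X' ⊆ X)
    (hH : ratPointsLE X H ⊆ X') :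
    ratPointsLE (transPart X) H ⊆ ratPointsLE (transPart X') H := by
  intro x hx
  have hxX : x ∈ ratPointsLE X H := ratPointsLE_mono_left (transPart_subset X) H hx
  exact ⟨inter_transPart_subset_transPart h' ⟨hH hxX, hx.1⟩, hx.2⟩

/-- Truncation to a box: for `M ≥ H`, `X^trans(ℚ, H) ⊆ (X ∩ [-M, M]^n)^trans(ℚ, H)`.
[cite: BinyaminiNovikovZak2024, proof of Cor. 1] -/
theorem ratPointsLE_transPart_subset_inter_box (X : Set (ι → ℝ)) {H : ℕ} {M : ℝ}
    (hM : (H : ℝ) ≤ M) :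
    ratPointsLE (transPart X) H ⊆ ratPointsLE (transPart (X ∩ {x | ∀ i, |x i| ≤ M})) H :=
  ratPointsLE_transPart_subset Set.inter_subset_left (ratPointsLE_subset_inter_box X hM)

/-- Counting form of the truncation step: if `X(ℚ, H) ⊆ X' ⊆ X ⊆ ℝⁿ` then
`#X^trans(ℚ, H) ≤ #X'^trans(ℚ, H)`. [cite: BinyaminiNovikovZak2024, proof of Cor. 1] -/
theorem ncard_ratPointsLE_transPart_le [Finite ι] {X X' : Set (ι → ℝ)} {H : ℕ} (h' : X' ⊆ X)
    (hH : ratPointsLE X H ⊆ X') :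
    (ratPointsLE (transPart X) H).ncard ≤ (ratPointsLE (transPart X') H).ncard :=
  Set.ncard_le_ncard (ratPointsLE_transPart_subset h' hH) (ratPointsLE_finite _ H)

/-- **Choice of `M ≫ 1` in the printed proof of Cor. 1.** If `X = π(Y)` for a map
`π : ℝ^N → ℝⁿ` and `Y ⊆ ℝ^N`, then for every `H` there is `M` with
`X(ℚ, H) ⊆ π(Y ∩ [-M, M]^N)` (`X(ℚ, H)` is finite; bound finitely many chosen preimages).
[cite: BinyaminiNovikovZak2024, proof of Cor. 1] -/
theorem exists_ratPointsLE_image_subset [Finite ι] {N : Type*} [Finite N]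
    (π : (N → ℝ) → (ι → ℝ)) (Y : Set (N → ℝ)) (H : ℕ) :
    ∃ M : ℝ, ratPointsLE (π '' Y) H ⊆ π '' (Y ∩ {y | ∀ j, |y j| ≤ M}) := by
  set S := ratPointsLE (π '' Y) H with hS
  have hSfin : S.Finite := ratPointsLE_finite _ H
  have hpre : ∀ x : S, ∃ y ∈ Y, π y = x := fun x ↦ x.2.1
  choose f hfY hfπ using hpre
  haveI : Finite S := hSfin.to_subtype
  obtain ⟨M, hM⟩ := (Set.finite_range fun p : S × N ↦ |f p.1 p.2|).bddAbove
  refine ⟨M, fun x hx ↦ ⟨f ⟨x, hx⟩, ⟨hfY _, fun j ↦ hM ⟨(⟨x, hx⟩, j), rfl⟩⟩, hfπ _⟩⟩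

/-- The printed reduction, projection form: if `X = π(Y)` then for every `H` there is `M` such
that `#X^trans(ℚ, H) ≤ #X_M^trans(ℚ, H)` with `X_M := π(Y ∩ [-M, M]^N) ⊆ X`
(Binyamini–Novikov–Zak 2024, proof of Cor. 1, the displayed inequality).
[cite: BinyaminiNovikovZak2024, proof of Cor. 1] -/
theorem exists_ncard_ratPointsLE_transPart_image_le [Finite ι] {N : Type*} [Finite N]
    (π : (N → ℝ) → (ι → ℝ)) (Y : Set (N → ℝ)) (H : ℕ) :
    ∃ M : ℝ, ratPointsLE (transPart (π '' Y)) H ⊆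
        ratPointsLE (transPart (π '' (Y ∩ {y | ∀ j, |y j| ≤ M}))) H ∧
      (ratPointsLE (transPart (π '' Y)) H).ncard ≤
        (ratPointsLE (transPart (π '' (Y ∩ {y | ∀ j, |y j| ≤ M}))) H).ncard := by
  obtain ⟨M, hM⟩ := exists_ratPointsLE_image_subset π Y H
  have h' : π '' (Y ∩ {y | ∀ j, |y j| ≤ M}) ⊆ π '' Y := Set.image_mono Set.inter_subset_left
  exact ⟨M, ratPointsLE_transPart_subset h' hM, ncard_ratPointsLE_transPart_le h' hM⟩

/-- Since `X^trans(ℚ, H)` is always finite, `BinyaminiNovikovZak2024_cor_1_rat` is equivalent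
to its counting half: a polylogarithmic bound on `#X^trans(ℚ, H)`. [folklore] -/
theorem BinyaminiNovikovZak2024_cor_1_rat_iff_ncard :
    BinyaminiNovikovZak2024_cor_1_rat ↔
      ∀ (n : ℕ) (X : Set (Fin n → ℝ)),
        (Set.univ : Set ℝ).Definable Language.orderedExpRing X →
          ∃ (c : ℝ) (κ : ℕ), ∀ H : ℕ, 1 ≤ H →
            ((ratPointsLE (transPart X) H).ncard : ℝ) ≤ c * (Real.log H + 1) ^ κ := by
  refine ⟨fun h n X hX ↦ ?_, fun h n X hX ↦ ?_⟩
  · obtain ⟨c, κ, hcκ⟩ := h n X hX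
    exact ⟨c, κ, fun H hH ↦ (hcκ H hH).2⟩
  · obtain ⟨c, κ, hcκ⟩ := h n X hX
    exact ⟨c, κ, fun H hH ↦ ⟨ratPointsLE_transPart_finite X H, hcκ H hH⟩⟩

/-- **Reduction of Cor. 1 to bounded definable sets** (the shape in which Thm. 1 is applied in
the printed proof): it suffices to bound `#X_M^trans(ℚ, H)` for the box truncations
`X_M = X ∩ [-M, M]^n` of a definable `X`, polylogarithmically in `H` and *uniformly in `M`*.
[cite: BinyaminiNovikovZak2024, proof of Cor. 1] -/
theorem BinyaminiNovikovZak2024_cor_1_rat_of_boxes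
    (h : ∀ (n : ℕ) (X : Set (Fin n → ℝ)),
      (Set.univ : Set ℝ).Definable Language.orderedExpRing X →
        ∃ (c : ℝ) (κ : ℕ), ∀ (M : ℝ) (H : ℕ), 1 ≤ H →
          ((ratPointsLE (transPart (X ∩ {x | ∀ i, |x i| ≤ M})) H).ncard : ℝ) ≤
            c * (Real.log H + 1) ^ κ) :
    BinyaminiNovikovZak2024_cor_1_rat := by
  rw [BinyaminiNovikovZak2024_cor_1_rat_iff_ncard]
  intro n X hX
  obtain ⟨c, κ, hcκ⟩ := h n X hX
  refine ⟨c, κ, fun H hH ↦ le_trans ?_ (hcκ H H hH)⟩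
  exact_mod_cast ncard_ratPointsLE_transPart_le Set.inter_subset_left
    (ratPointsLE_subset_inter_box X le_rfl)

end Truncation

/-! ### Step 1 of the printed proof given (MC): definable sets are projections of exponential
zero sets; Cor. 1 modulo Theorem 1 -/

section ModelComplete

/-- **(MC) ⇒ definable subsets of `ℝⁿ` are projections of real exponential zero sets** — step 1
of the printed proof of Cor. 1 (*"By Wilkie's theorem of the complement we have `X = π_n(Y)`
where `Y ⊂ ℝ^N` is quantifier-free in `ℝ_exp`, and `π_n : ℝ^N → ℝⁿ` is the projection to the
first `n` coordinates"*), in the normal form of `exists_eq_image_realZeroSet_of_definable₁`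
(`RealExpOMinimal.lean`, the case `n = 1`): if `Th(ℝ_exp)` is model complete, every
`X ⊆ ℝⁿ` definable with parameters in `ℝ_exp` is the projection to the first `n` coordinates of
the zero set `Z(Q) = {z̄ ∈ ℝⁿ⁺ᴺ | Q(z̄, e^{z̄}) = 0}` of a real polynomial `Q` (finitely many
parameters; Robinson's test; existential formulas are `∃ w̄, t(v̄, w̄) = 0`; nested exponentials
unravelled to an exponential polynomial; parameters ↦ coefficients).
[cite: BinyaminiNovikovZak2024, proof of Cor. 1] [cite: DenBesten2016, Cor. 8.3.5 (proof) and Cor. 4.2.7 (proof)] -/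
theorem exists_eq_image_realZeroSet_of_definable (hmc : wilkie_isModelComplete) {n : ℕ}
    {X : Set (Fin n → ℝ)} (hX : (Set.univ : Set ℝ).Definable Language.orderedExpRing X) :
    ∃ (N : ℕ) (Q : MvPolynomial (Fin (n + N) ⊕ Fin (n + N)) ℝ),
      X = (fun z : Fin (n + N) → ℝ => fun i : Fin n => z (Fin.castAdd N i)) ''
        ExpPoly.realZeroSet Q := by
  classical
  -- finitely many parameters suffice
  obtain ⟨A0, -, hA0⟩ := Set.definable_iff_finitely_definable.1 hX
  obtain ⟨φ, hφ⟩ := Set.definable_iff_exists_formula_sum.1 hA0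
  -- number the parameters and the variables by `Fin k`
  haveI : Fintype (↥(A0 : Set ℝ)) := (A0 : Set ℝ).toFinite.fintype
  let e : (↥(A0 : Set ℝ) ⊕ Fin n) ≃ Fin (Fintype.card (↥(A0 : Set ℝ) ⊕ Fin n)) :=
    Fintype.equivFin _
  set k := Fintype.card (↥(A0 : Set ℝ) ⊕ Fin n)
  -- Robinson's test: an equivalent existential formula
  obtain ⟨ψ, hψE, hiff⟩ :=
    Language.Theory.IsModelComplete.exists_isExistential_iff hmc k (φ.relabel e)
  -- existential formulas are projections of term zero sets, then of exponential zero sets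
  obtain ⟨N', t, ht⟩ := RealExpModel.exists_term_iff_realize_of_isExistential hψE
  obtain ⟨N, p, hp⟩ := RealExpModel.exists_expPoly_iff_real t
  -- the assignment of the `Fin k` variables at the real point `x`
  let val : (Fin n → ℝ) → Fin k → ℝ := fun x =>
    Sum.elim ((↑) : ↥(A0 : Set ℝ) → ℝ) x ∘ e.symm
  have hmem : ∀ x : Fin n → ℝ, x ∈ X ↔ ∃ y : Fin N → ℝ,
      p.realize (Sum.elim (Sum.elim (val x) Fin.elim0) (ExpPoly.expPt y)) = 0 := by
    intro x
    have h1 : x ∈ X ↔ φ.Realize (Sum.elim ((↑) : ↥(A0 : Set ℝ) → ℝ) x) := by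
      have := Set.ext_iff.1 hφ x
      simpa using this
    rw [h1, ← hp, ← ht (val x), ← hiff.realize_iff, Formula.realize_relabel]
    simp [val, Function.comp_assoc]
  -- the real polynomial: parameters ↦ coefficients, the variables ↦ the first `n` unknowns
  let σ : (Fin k ⊕ Fin 0) ⊕ (Fin N ⊕ Fin N) → MvPolynomial (Fin (n + N) ⊕ Fin (n + N)) ℝ :=
    Sum.elim
      (Sum.elim (fun i => Sum.elim (fun a : ↥(A0 : Set ℝ) => MvPolynomial.C (a : ℝ))
        (fun i' : Fin n => MvPolynomial.X (Sum.inl (Fin.castAdd N i'))) (e.symm i)) Fin.elim0)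
      (Sum.elim (fun j => MvPolynomial.X (Sum.inl (Fin.natAdd n j)))
        (fun j => MvPolynomial.X (Sum.inr (Fin.natAdd n j))))
  have key : ∀ z : Fin (n + N) → ℝ,
      (fun v => MvPolynomial.eval (ExpPoly.expPt z) (σ v)) =
        Sum.elim (Sum.elim (val fun i => z (Fin.castAdd N i)) Fin.elim0)
          (ExpPoly.expPt fun j => z (Fin.natAdd n j)) := by
    intro z
    funext v
    rcases v with (i | i) | (j | j)
    · simp only [σ, Sum.elim_inl]
      cases h : e.symm i with
      | inl a => simp [val, h]
      | inr o => simp [val, h]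
    · exact i.elim0
    · simp [σ]
    · simp [σ]
  refine ⟨N, Language.orderedRing.termSubstMvPoly σ p, Set.ext fun x => ?_⟩
  rw [hmem x, Set.mem_image]
  constructor
  · rintro ⟨y, hy⟩
    refine ⟨Fin.append x y, ?_, ?_⟩
    · rw [ExpPoly.mem_realZeroSet, Language.orderedRing.eval_termSubstMvPoly, key]
      simpa using hy
    · funext i
      simp
  · rintro ⟨z, hz, rfl⟩
    refine ⟨fun j => z (Fin.natAdd n j), ?_⟩
    rw [ExpPoly.mem_realZeroSet, Language.orderedRing.eval_termSubstMvPoly, key] at hz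
    exact hz

/-- **The printed proof of Cor. 1, modulo Theorem 1.** Hypotheses: **(MC)** the named fact
`wilkie_isModelComplete` (Wilkie 1996 — step 1, through
`exists_eq_image_realZeroSet_of_definable`); **(Thm. 1, as it enters the proof)** for the zero
set `Z(Q) ⊆ ℝⁿ⁺ᴺ` of a real exponential polynomial and its box truncations
`Y_M = Z(Q) ∩ [-M, M]ⁿ⁺ᴺ` — *"restricted semi-Pfaffian … Crucially, `Y_M ∈ Ω_{F,D}` where `F, D`
depend on `Y` but not on `M`. Then the same is true for `X_M`"* `:= π_n(Y_M)`, so that Theorem 1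
gives `#X_M^trans(ℚ, H) ≤ poly(log H)` **uniformly in `M`** — spelled out as the hypothesis `h1`,
since Theorem 1 (sharply o-minimal point counting for `ℝ_rPfaff`) has no counterpart in the tree.
Conclusion: `BinyaminiNovikovZak2024_cor_1_rat`, by step 2 (`exists_ncard_ratPointsLE_transPart_image_le`:
*"choose `M ≫ 1` such that `X(g, H) = X_M(g, H)` … `#X^trans(g, H) ≤ #X_M^trans(g, H)`"*).
[cite: BinyaminiNovikovZak2024, Cor. 1 (proof)] -/
theorem BinyaminiNovikovZak2024_cor_1_rat_of_isModelComplete (hMC : wilkie_isModelComplete)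
    (h1 : ∀ (n N : ℕ) (Q : MvPolynomial (Fin (n + N) ⊕ Fin (n + N)) ℝ),
      ∃ (c : ℝ) (κ : ℕ), ∀ (M : ℝ) (H : ℕ), 1 ≤ H →
        ((ratPointsLE (transPart ((fun z : Fin (n + N) → ℝ => fun i : Fin n =>
            z (Fin.castAdd N i)) '' (ExpPoly.realZeroSet Q ∩ {z | ∀ j, |z j| ≤ M}))) H).ncard :
              ℝ) ≤ c * (Real.log H + 1) ^ κ) :
    BinyaminiNovikovZak2024_cor_1_rat := by
  rw [BinyaminiNovikovZak2024_cor_1_rat_iff_ncard]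
  intro n X hX
  obtain ⟨N, Q, rfl⟩ := exists_eq_image_realZeroSet_of_definable hMC hX
  obtain ⟨c, κ, hcκ⟩ := h1 n N Q
  refine ⟨c, κ, fun H hH => ?_⟩
  obtain ⟨M, -, hM⟩ := exists_ncard_ratPointsLE_transPart_image_le
    (fun z : Fin (n + N) → ℝ => fun i : Fin n => z (Fin.castAdd N i)) (ExpPoly.realZeroSet Q) H
  exact le_trans (by exact_mod_cast hM) (hcκ M H hH)

end ModelComplete

/-! ### The cases `n ≤ 1`: o-minimality alone -/

section LowDimension

/-- A finite union of rays is, off a finite set, locally constant: for every `x` outside a finite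
set there is an open interval around `x` inside `s` or inside `sᶜ` (induction over the Boolean
closure generated by the rays `(-∞, a)`, `(a, ∞)`; van den Dries 1998, Ch. 1, (3.2)).
[cite: Dries1998, Ch. 1 (3.2)] -/
theorem IsFiniteUnionOfIntervals.exists_finite_forall_Ioo_subset {s : Set ℝ}
    (hs : IsFiniteUnionOfIntervals s) :
    ∃ F : Set ℝ, F.Finite ∧ ∀ x ∉ F, ∃ a b : ℝ, a < x ∧ x < b ∧ (Ioo a b ⊆ s ∨ Ioo a b ⊆ sᶜ) := by
  induction hs using BooleanSubalgebra.closure_bot_sup_induction with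
  | mem t ht =>
    rcases ht with ⟨a, rfl⟩ | ⟨a, rfl⟩
    · refine ⟨{a}, finite_singleton a, fun x hx => ?_⟩
      rcases lt_or_gt_of_ne hx with h | h
      · exact ⟨x - 1, a, by linarith, h, Or.inl fun y hy => hy.2⟩
      · exact ⟨a, x + 1, h, by linarith, Or.inr fun y hy => not_lt.mpr (le_of_lt hy.1)⟩
    · refine ⟨{a}, finite_singleton a, fun x hx => ?_⟩
      rcases lt_or_gt_of_ne hx with h | h
      · exact ⟨x - 1, a, by linarith, h, Or.inr fun y hy => not_lt.mpr (le_of_lt hy.2)⟩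
      · exact ⟨a, x + 1, h, by linarith, Or.inl fun y hy => hy.1⟩
  | bot => exact ⟨∅, finite_empty, fun x _ => ⟨x - 1, x + 1, by linarith, by linarith,
      Or.inr fun y _ => by simp⟩⟩
  | sup s _ t _ ihs iht =>
    obtain ⟨F, hF, hs⟩ := ihs
    obtain ⟨G, hG, ht⟩ := iht
    refine ⟨F ∪ G, hF.union hG, fun x hx => ?_⟩
    rw [mem_union, not_or] at hx
    obtain ⟨a, b, ha, hb, h1⟩ := hs x hx.1
    obtain ⟨a', b', ha', hb', h2⟩ := ht x hx.2
    refine ⟨max a a', min b b', max_lt ha ha', lt_min hb hb', ?_⟩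
    have sub1 : Ioo (max a a') (min b b') ⊆ Ioo a b :=
      Ioo_subset_Ioo (le_max_left _ _) (min_le_left _ _)
    have sub2 : Ioo (max a a') (min b b') ⊆ Ioo a' b' :=
      Ioo_subset_Ioo (le_max_right _ _) (min_le_right _ _)
    rcases h1 with h1 | h1
    · exact Or.inl fun y hy => Or.inl (h1 (sub1 hy))
    · rcases h2 with h2 | h2
      · exact Or.inl fun y hy => Or.inr (h2 (sub2 hy))
      · refine Or.inr fun y hy hy' => ?_
        rcases hy' with hy' | hy'
        · exact h1 (sub1 hy) hy'
        · exact h2 (sub2 hy) hy'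
  | compl s _ ih =>
    obtain ⟨F, hF, hs⟩ := ih
    refine ⟨F, hF, fun x hx => ?_⟩
    obtain ⟨a, b, ha, hb, h⟩ := hs x hx
    refine ⟨a, b, ha, hb, ?_⟩
    rcases h with h | h
    · exact Or.inr (by rwa [compl_compl])
    · exact Or.inl h

/-- **The transcendental part of a finite union of points and intervals is finite**: if the set of
`t` with `(t) ∈ X ⊆ ℝ¹` is a finite union of points and intervals, every point of `X` off a finite
set lies on an open interval `(a, b) ⊆ X`, which (as a subset of `ℝ¹`) is semialgebraic,
connected and infinite, hence in `X^alg`. [folklore] -/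
theorem transPart_finite_of_isFiniteUnionOfIntervals {X : Set (Fin 1 → ℝ)}
    (hX : IsFiniteUnionOfIntervals {t : ℝ | (fun _ : Fin 1 => t) ∈ X}) : (transPart X).Finite := by
  obtain ⟨F, hF, hloc⟩ := hX.exists_finite_forall_Ioo_subset
  refine (hF.image fun t : ℝ => fun _ : Fin 1 => t).subset fun x hx => ?_
  rw [mem_transPart_iff] at hx
  have hxe : x = fun _ => x 0 := funext fun i => congrArg x (Subsingleton.elim i 0)
  by_contra hxF
  have hx0 : x 0 ∉ F := fun h => hxF ⟨x 0, h, hxe.symm⟩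
  obtain ⟨a, b, ha, hb, h⟩ := hloc (x 0) hx0
  have hxs : x 0 ∈ {t : ℝ | (fun _ : Fin 1 => t) ∈ X} := by
    show (fun _ : Fin 1 => x 0) ∈ X
    exact hxe ▸ hx.1
  rcases h with h | h
  · -- the interval `(a, b) ⊆ X` around `x` puts `x` in `X^alg`
    set A : Set (Fin 1 → ℝ) := Set.pi univ fun _ : Fin 1 => Ioo a b with hA
    have hAX : A ⊆ X := fun y hy => by
      have hye : y = fun _ => y 0 := funext fun i => congrArg y (Subsingleton.elim i 0)
      rw [hye]
      exact h (hy 0 (mem_univ 0))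
    have hAsa : IsSemialgebraic ℝ A := by
      have h1 := (isSemialgebraic_setOf_eval_lt (k := ℝ) (R := ℝ) (ι := Fin 1)
        (MvPolynomial.C a) (MvPolynomial.X 0)).inter
        (isSemialgebraic_setOf_eval_lt (k := ℝ) (R := ℝ) (ι := Fin 1)
          (MvPolynomial.X 0) (MvPolynomial.C b))
      have hAeq : A = {y : Fin 1 → ℝ | MvPolynomial.aeval y (MvPolynomial.C a : MvPolynomial (Fin 1) ℝ) <
            MvPolynomial.aeval y (MvPolynomial.X 0 : MvPolynomial (Fin 1) ℝ)} ∩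
          {y : Fin 1 → ℝ | MvPolynomial.aeval y (MvPolynomial.X 0 : MvPolynomial (Fin 1) ℝ) <
            MvPolynomial.aeval y (MvPolynomial.C b : MvPolynomial (Fin 1) ℝ)} := by
        ext y
        simp [hA, Set.mem_pi, Fin.forall_fin_one]
      rw [hAeq]
      exact h1
    have hAconv : Convex ℝ A := convex_pi fun _ _ => convex_Ioo a b
    have hxA : x ∈ A := fun i _ => by
      rw [Subsingleton.elim i 0]; exact ⟨ha, hb⟩
    have hAconn : IsConnected A := ⟨⟨x, hxA⟩, hAconv.isPreconnected⟩
    have hAinf : A.Infinite := by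
      have himg : (fun t : ℝ => fun _ : Fin 1 => t) '' Ioo a b ⊆ A := by
        rintro _ ⟨t, ht, rfl⟩ i _
        exact ht
      exact ((Ioo_infinite (ha.trans hb)).image fun t _ t' _ htt' => by
        simpa using congrFun htt' 0).mono himg
    exact hx.2 (mem_algPart_iff.mpr ⟨A, hxA, hAX, hAsa, hAconn, hAinf⟩)
  · exact h ⟨ha, hb⟩ hxs

/-- **Wilkie's conjecture for `n = 1` is o-minimality**: if `ℝ_exp` is o-minimal
(`wilkie_isOMinimal`, = Wilkie's theorem + Khovanskii; cf. `wilkie_isOMinimal_of_isModelComplete`),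
then for every `X ⊆ ℝ¹` definable in `ℝ_exp` the transcendental part `X^trans` is finite, so
`#X^trans(ℚ, H) ≤ #X^trans · (log H + 1)^0` — the case `n = 1` of `BinyaminiNovikovZak2024_cor_1_rat`
(the content of the conjecture starts at `n = 2`). [folklore] [cite: BinyaminiNovikovZak2024, Cor. 1 (case n = 1)] -/
theorem BinyaminiNovikovZak2024_cor_1_rat_one_of_isOMinimal (hO : wilkie_isOMinimal)
    (X : Set (Fin 1 → ℝ)) (hX : (univ : Set ℝ).Definable Language.orderedExpRing X) :
    ∃ (c : ℝ) (κ : ℕ), ∀ H : ℕ, 1 ≤ H →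
      (ratPointsLE (transPart X) H).Finite ∧
        ((ratPointsLE (transPart X) H).ncard : ℝ) ≤ c * (Real.log H + 1) ^ κ := by
  have hdef : (univ : Set ℝ).Definable₁ Language.orderedExpRing {t : ℝ | (fun _ : Fin 1 => t) ∈ X} := by
    unfold Set.Definable₁
    convert hX using 1
    ext x
    have hxe : (fun _ : Fin 1 => x 0) = x := funext fun i => congrArg x (Subsingleton.elim 0 i)
    simp [hxe]
  have hfin : (transPart X).Finite := transPart_finite_of_isFiniteUnionOfIntervals (hO _ hdef)
  refine ⟨(transPart X).ncard, 0, fun H _ => ⟨hfin.subset (ratPointsLE_subset _ _), ?_⟩⟩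
  rw [pow_zero, mul_one]
  exact_mod_cast Set.ncard_le_ncard (ratPointsLE_subset _ _) hfin

/-- The case `n = 0` of `BinyaminiNovikovZak2024_cor_1_rat` is trivial (`ℝ⁰` is a point). [folklore] -/
theorem BinyaminiNovikovZak2024_cor_1_rat_zero (X : Set (Fin 0 → ℝ)) :
    ∃ (c : ℝ) (κ : ℕ), ∀ H : ℕ, 1 ≤ H →
      (ratPointsLE (transPart X) H).Finite ∧
        ((ratPointsLE (transPart X) H).ncard : ℝ) ≤ c * (Real.log H + 1) ^ κ := by
  refine ⟨1, 0, fun H _ => ⟨Set.toFinite _, ?_⟩⟩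
  rw [pow_zero, mul_one]
  have h := Set.ncard_le_ncard (Set.subset_univ (ratPointsLE (transPart X) H)) Set.finite_univ
  rw [Set.ncard_univ, Nat.card_unique] at h
  exact_mod_cast h

end LowDimension

end Literature.ModelTheory.ExponentialFields

end
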